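import Summits.BirchSwinnertonDyer.Rank1Residual.X11b.CongruenceLimitOneSided
import HarnessLib

/-!
# Route `ErratumRoadFive` (K2, `p ≥ 5`), crux (T) `Rest3TorsionBranchAtFive` (item
# stmt-BirchSwinnertonDyer-19702): the ONE-SIDED congruence limit WITH A BOUNDED CONTROL DEFECT, and the
# cancellation of the defect by `μ = 0` — the commutative algebra of the erratum road WITHOUT
# hypothesis (iv) `E(ℚ_p)[p] = 0`

Cell `bsd-stepL` (run/shared/lean/pub/bsd-stepL/), seat `bsd-stepL-bdp` (prover g13, 2026-08-26), memo
`HOME/proof/PROOF-BDP.md` §31; `--supports stmt-BirchSwinnertonDyer-19702 --as helper`.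

HONEST FRAMING: PURE COMMUTATIVE ALGEBRA (theorems only; no definition, no named fact, no `sorry`);
nothing about Selmer groups, `p`-adic `L`-functions or any preprint is asserted; nothing is booked; BSD is
advanced for no class; no census word, tier or label moves (T7).

## What and why

On the 2 571 class-wide pairs of branch (T) of REST‴ that CARRY an erratum witness (an odd non-split
`E[p]`-ramified multiplicative `q ≠ p`; HOME/rest/CENSUS-REST3-BRANCHES.md §1) every hypothesis of
Castella's erratum Thm. 1.1 holds except (iv) `E(ℚ_p)[p] = 0`. In the erratum (iv) is used at ONE place
(p. 2, Lemma 2.1, verbatim): the exact control `Sel^Σ_𝔭(K, M_g[ϖ^m]) ≃ Sel^Σ_𝔭(K, M_g)[ϖ^m]`, whose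
only obstruction is «the kernel of the second arrow … `H⁰(K_𝔭, M_g)/ϖ^m H⁰(K_𝔭, M_g)` and this
vanishes when so does `H⁰(K_𝔭, A_g[ϖ])`». In the kernel this exact control is the binder
`e : M/I^m M ≃ N_m/I^m N_m` of multr1-p1's ONE-SIDED congruence limit
`CongruenceLimit.fittingIdeal_le_span_of_congruences` (`X11b/CongruenceLimitOneSided.lean`): from
`Fitt₀(N_m) ⊆ (L_m)` for the congruent forms `g_m`, `(L_m) + I^m = (L) + I^m` and `e`, Krull's
intersection theorem gives `Fitt₀(M) ⊆ (L)` (`M = X^Σ_ac(E[p^∞])`, `L = L^Σ_p(f)`).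

When (iv) FAILS the control is no longer exact but its defect is FINITE AND BOUNDED INDEPENDENTLY OF
`m` (memo §31.2: `H⁰(K_𝔭, M_E) = ⊕_{w ∣ 𝔭} E(K_{∞,w})[p^∞]` with `E(K_{∞,w})[p^∞] = E(ℚ_p)[p^∞] ≅
ℤ/p^k` over the anticyclotomic `ℤ_p`-extension — a Tate curve acquires no new `p`-power torsion in an
abelian pro-`p` extension of `ℚ_p`, `p` odd —, and the same module bounds the congruent `g_m` for
`m > k`). THIS FILE proves that the congruence limit TOLERATES such a defect: if an ideal `D` (the
Fitting ideal of the defect, e.g. `(p^c)`) satisfies `D·Fitt₀(Q_m) ⊆ Fitt₀(N_m) + I^m` for modules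
`Q_m` onto which `M` surjects (`Q_m` = the dual of the residual Selmer group `Sel^Σ_𝔭(K, M[ϖ^m])`,
common to `E` and `g_m`), then `D·Fitt₀(M) ⊆ (L)` (§1–§2); and that over `Λ_𝒪 = 𝒪⟦T⟧` a defect
`D = (π^c)` with `π` prime and `π ∤ L` (`π = ϖ`: `μ(L) = 0`, which on the erratum road follows from
(c) at `m = 1` and Hsieh's `μ = 0` for `g_1`) CANCELS: `Ch_Λ(M) ⊆ (L)` (§3–§4), whence the route's
inequality `ord L(0) ≤ ord f_ac(0)` at the trivial character. The defect binder `hD` is the shape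
produced by the extension inequality `Fitt₀(K)·Fitt₀(Q) ⊆ Fitt₀(N)` for `0 → K → N → Q → 0`
(Stacks 07ZA (4)) with `D ⊆ Fitt₀(K)`; §2 records the reduction of its right-hand side modulo
`I^m` (`Fitt₀(N/I^mN) ⊆ Fitt₀(N) + I^m`) and that the exact case `D = R` IS multr1-p1's theorem.

Dictionary (as in `CongruenceLimitOneSided.lean`): `R = Λ_𝒪` (or `Λ_𝒪^{ur}`), `I = (p)` or `(ϖ)`,
`M = X^Σ_ac(E[p^∞])`, `N m = X^Σ_ac(A_{g_m})`, `Q m = Sel^Σ_𝔭(K, M_E[p^m])^∨ ≅ Sel^Σ_𝔭(K, M_{g_m}[ϖ^m])^∨`,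
`L = L^Σ_p(f)`, `Lm m = L^Σ_p(g_m)`, `D = (p^c)` with `p^c ∈ Fitt_Λ` of every defect module (finite of
order `≤ p^{c'}`, exponent `p^k`).

References: [Castella2018Erratum] Lemma 2.1 and proof of Thm. 1.1 (pp. 2, 4); [Skinner2016PacificMC]
§3.1 (p. 192); [StacksProject] Tag 07ZA; Krull's intersection theorem; `X11b/CongruenceLimitOneSided.lean`,
`X11b/FittingCongruenceLimit.lean`, `X11b/FittingOfNoFiniteSubmodulePowerSeries.lean` (multr1-p1).
-/

set_option autoImplicit false
-- the Theorems namespace of this sub repeats the summit name by design (D-0017 nested layout)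
set_option linter.dupNamespace false

noncomputable section

open scoped TensorProduct

open Literature.RingTheory.FittingIdeal Literature.NumberTheory.EllipticCurves
  Literature.NumberTheory.EllipticCurves.Module PowerSeries IsDiscreteValuationRing IsLocalRing
  Summit.BirchSwinnertonDyer.Rank1Residual.X11b.CongruenceLimit

namespace Summit.BirchSwinnertonDyer.BirchSwinnertonDyer.Theorems.BoundedCongruenceLimit

universe u

/-! ### §1 The one-sided congruence limit with a defect ideal (any Noetherian ring) -/

section OneSided

variable {R : Type u} [CommRing R] (I D : Ideal R)
  {M : Type*} [AddCommGroup M] [Module R M] {L : R}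
  (N : ℕ → Type*) [∀ m, AddCommGroup (N m)] [∀ m, Module R (N m)]
  (Q : ℕ → Type*) [∀ m, AddCommGroup (Q m)] [∀ m, Module R (Q m)]
  (Lm : ℕ → R)

/-- **(Fitt-L-≤) modulo `I^m`, WITH A DEFECT.** For each `m ≥ 1`: a surjection `M ↠ Q_m` (`α`; the dual
of `Sel(M_E[p^m]) ↪ Sel(M_E)[p^m]`), the DEFECT bound `D·Fitt₀(Q_m) ⊆ Fitt₀(N_m) + I^m` (`hD`; the
bounded control for `g_m`), the one-sided input `Fitt₀(N_m) ⊆ (L_m)` (`hF`; (2.5) for `g_m`) and the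
congruence `(L_m) + I^m = (L) + I^m` (`hc`; (c)) give `D·Fitt₀(M) ⊆ (L) + I^m`. Bookkeeping:
`Fitt₀` is monotone along surjections (`Module.fittingIdeal_le_of_surjective`). [cite: Castella2018Erratum, proof of Thm. 1.1 (p. 4), display, read with a defect]
[cite: StacksProject, Tag 07ZA (3)] -/
theorem mul_fittingIdeal_le_sup_pow_of_congruences
    (α : ∀ m : ℕ, 1 ≤ m → (M →ₗ[R] Q m))
    (hα : ∀ (m : ℕ) (hm : 1 ≤ m), Function.Surjective (α m hm))
    (hD : ∀ m : ℕ, 1 ≤ m →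
      D * Module.fittingIdeal R (Q m) 0 ≤ Module.fittingIdeal R (N m) 0 ⊔ I ^ m)
    (hF : ∀ m : ℕ, 1 ≤ m → Module.fittingIdeal R (N m) 0 ≤ Ideal.span {Lm m})
    (hc : ∀ m : ℕ, 1 ≤ m → Ideal.span {Lm m} ⊔ I ^ m = Ideal.span {L} ⊔ I ^ m)
    (m : ℕ) (hm : 1 ≤ m) :
    D * Module.fittingIdeal R M 0 ≤ Ideal.span {L} ⊔ I ^ m :=
  calc D * Module.fittingIdeal R M 0 ≤ D * Module.fittingIdeal R (Q m) 0 :=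
        Ideal.mul_mono_right (Module.fittingIdeal_le_of_surjective (α m hm) (hα m hm) 0)
    _ ≤ Module.fittingIdeal R (N m) 0 ⊔ I ^ m := hD m hm
    _ ≤ Ideal.span {Lm m} ⊔ I ^ m := sup_le_sup_right (hF m hm) _
    _ = Ideal.span {L} ⊔ I ^ m := hc m hm

/-- **The one-sided congruence limit WITH A BOUNDED DEFECT.** Under the hypotheses of
`mul_fittingIdeal_le_sup_pow_of_congruences` for every `m ≥ 1`, with `R` Noetherian and `I ⊆ Jac(R)`:
`D·Fitt₀(M) ⊆ ⋂_m ((L) + I^m) = (L)` (Krull, multr1-p1 `CongruenceLimit.iInf_sup_pow_eq_self`). With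
`D = R` and `Q_m = N_m/I^mN_m` this is `CongruenceLimit.fittingIdeal_le_span_of_congruences` (§2); the
point is that `D` — the Fitting ideal of the control defect — may be a PROPER ideal of finite index,
independent of `m`. No hypothesis `L ≠ 0`, no torsionness of the `N_m`. [cite: Castella2018Erratum, proof of Thm. 1.1 (p. 4)]
[cite: Skinner2016PacificMC, §3.1 (p. 192)] -/
theorem mul_fittingIdeal_le_span_of_congruences [IsNoetherianRing R]
    (hI : I ≤ (⊥ : Ideal R).jacobson)
    (α : ∀ m : ℕ, 1 ≤ m → (M →ₗ[R] Q m))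
    (hα : ∀ (m : ℕ) (hm : 1 ≤ m), Function.Surjective (α m hm))
    (hD : ∀ m : ℕ, 1 ≤ m →
      D * Module.fittingIdeal R (Q m) 0 ≤ Module.fittingIdeal R (N m) 0 ⊔ I ^ m)
    (hF : ∀ m : ℕ, 1 ≤ m → Module.fittingIdeal R (N m) 0 ≤ Ideal.span {Lm m})
    (hc : ∀ m : ℕ, 1 ≤ m → Ideal.span {Lm m} ⊔ I ^ m = Ideal.span {L} ⊔ I ^ m) :
    D * Module.fittingIdeal R M 0 ≤ Ideal.span {L} := by
  rw [← iInf_sup_pow_eq_self I (Ideal.span {L}) hI]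
  refine le_iInf fun m => ?_
  rcases Nat.eq_zero_or_pos m with rfl | hm
  · rw [pow_zero, Ideal.one_eq_top, sup_top_eq]; exact le_top
  · exact mul_fittingIdeal_le_sup_pow_of_congruences I D N Q Lm α hα hD hF hc m hm

end OneSided

/-! ### §2 The shape of the defect binder: reduction modulo `I^m`, and the exact case -/

section DefectShape

variable {R : Type u} [CommRing R]

/-- `J` kills `N/JN`: the submodule `J • ⊤` of `N ⧸ J • ⊤` is zero. [folklore] -/
theorem smul_top_quotient_eq_bot (J : Ideal R) (N : Type*) [AddCommGroup N] [Module R N] :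
    (J • (⊤ : Submodule R (N ⧸ (J • (⊤ : Submodule R N))))) = ⊥ := by
  refine (Submodule.smul_le.mpr fun r hr n _ => ?_).antisymm bot_le
  obtain ⟨x, rfl⟩ := Submodule.mkQ_surjective _ n
  rw [Submodule.mem_bot, ← map_smul, Submodule.mkQ_apply, Submodule.Quotient.mk_eq_zero]
  exact Submodule.smul_mem_smul hr Submodule.mem_top

/-- **`Fitt₀(N/JN) ⊆ Fitt₀(N) + J`** (Fitting ideals commute with base change, Stacks 07ZA (3); here
via multr1-p1's `fittingIdeal_sup_eq_of_quotEquiv` applied to `(N/JN)/J(N/JN) ≅ N/JN`). This turns a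
defect bound stated on `N_m/I^mN_m` — the target of the extension inequality
`Fitt₀(K_m)·Fitt₀(Q_m) ⊆ Fitt₀(N_m/I^mN_m)` for `0 → K_m → N_m/I^mN_m → Q_m → 0` — into the binder
`hD` of §1. [cite: StacksProject, Tag 07ZA (3)] -/
theorem fittingIdeal_quotient_le_sup (J : Ideal R) (N : Type*) [AddCommGroup N] [Module R N]
    [Module.Finite R N] (k : ℕ) :
    Module.fittingIdeal R (N ⧸ (J • (⊤ : Submodule R N))) k ≤ Module.fittingIdeal R N k ⊔ J := by
  have e : ((N ⧸ (J • (⊤ : Submodule R N))) ⧸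
      (J • (⊤ : Submodule R (N ⧸ (J • (⊤ : Submodule R N)))))) ≃ₗ[R]
      (N ⧸ (J • (⊤ : Submodule R N))) :=
    Submodule.quotEquivOfEqBot _ (smul_top_quotient_eq_bot J N)
  have h := fittingIdeal_sup_eq_of_quotEquiv J e k
  exact le_sup_left.trans h.le

/-- **The defect binder from a bound on `N_m/I^mN_m`.** If `D·Fitt₀(Q) ⊆ Fitt₀(N/I^mN)` then
`D·Fitt₀(Q) ⊆ Fitt₀(N) + I^m`. [cite: StacksProject, Tag 07ZA (3)] -/
theorem defect_le_sup_of_le_quotient (I D : Ideal R) (m : ℕ) (N Q : Type*) [AddCommGroup N]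
    [Module R N] [Module.Finite R N] [AddCommGroup Q] [Module R Q]
    (h : D * Module.fittingIdeal R Q 0 ≤
      Module.fittingIdeal R (N ⧸ (I ^ m • (⊤ : Submodule R N))) 0) :
    D * Module.fittingIdeal R Q 0 ≤ Module.fittingIdeal R N 0 ⊔ I ^ m :=
  h.trans (fittingIdeal_quotient_le_sup (I ^ m) N 0)

/-- **The EXACT case is multr1-p1's theorem.** With no defect (`D = R`) and `Q_m = N_m/I^mN_m`, an
`R`-linear isomorphism `e_m : M/I^mM ≅ N_m/I^mN_m` (Lemma 2.1 under (iv)) supplies the surjection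
`M ↠ Q_m` and the defect binder, so §1 returns `Fitt₀(M) ⊆ (L)` — literally
`CongruenceLimit.fittingIdeal_le_span_of_congruences`. (Consistency check; the erratum's printed road.)
[cite: Castella2018Erratum, Lemma 2.1 and proof of Thm. 1.1 (pp. 2, 4)] -/
theorem fittingIdeal_le_span_of_congruences_exact [IsNoetherianRing R] (I : Ideal R)
    (hI : I ≤ (⊥ : Ideal R).jacobson)
    {M : Type*} [AddCommGroup M] [Module R M] {L : R}
    (N : ℕ → Type*) [∀ m, AddCommGroup (N m)] [∀ m, Module R (N m)] [∀ m, Module.Finite R (N m)]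
    (Lm : ℕ → R)
    (e : ∀ m : ℕ, 1 ≤ m →
      ((M ⧸ (I ^ m • (⊤ : Submodule R M))) ≃ₗ[R] (N m ⧸ (I ^ m • (⊤ : Submodule R (N m))))))
    (hF : ∀ m : ℕ, 1 ≤ m → Module.fittingIdeal R (N m) 0 ≤ Ideal.span {Lm m})
    (hc : ∀ m : ℕ, 1 ≤ m → Ideal.span {Lm m} ⊔ I ^ m = Ideal.span {L} ⊔ I ^ m) :
    Module.fittingIdeal R M 0 ≤ Ideal.span {L} := by
  have h := mul_fittingIdeal_le_span_of_congruences I ⊤ N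
    (fun m => N m ⧸ (I ^ m • (⊤ : Submodule R (N m)))) Lm hI
    (fun m hm => (e m hm).toLinearMap ∘ₗ (I ^ m • (⊤ : Submodule R M)).mkQ)
    (fun m hm => (e m hm).surjective.comp (Submodule.mkQ_surjective _))
    (fun m _ => by
      rw [Ideal.top_mul]
      exact fittingIdeal_quotient_le_sup (I ^ m) (N m) 0)
    hF hc
  rwa [Ideal.top_mul] at h

end DefectShape

/-! ### §3 Cancellation of the defect in a unique factorisation monoid (`μ(L) = 0`) -/

section Cancel

variable {R : Type u} [CommRing R] [IsDomain R] [UniqueFactorizationMonoid R]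

/-- **Cancellation of a prime-power defect.** In a UFD, if `π` is prime, `π ∤ L` and `L ∣ π^c · f`,
then `L ∣ f` (`L` and `π^c` share no prime factor). On the erratum road `π = ϖ` (the constant series;
`ϖ ∤ L^Σ_p(f)` is `μ = 0`, from (c) at `m = 1` and Hsieh's `μ = 0` for `g_1`) and `π^c` is the defect.
[folklore] -/
theorem dvd_of_dvd_prime_pow_mul {π L f : R} (hπ : Prime π) (hL : ¬ π ∣ L) (c : ℕ)
    (h : L ∣ π ^ c * f) : L ∣ f := by
  have hL0 : L ≠ 0 := by rintro rfl; exact hL (dvd_zero π)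
  refine UniqueFactorizationMonoid.dvd_of_dvd_mul_right_of_no_prime_factors hL0 ?_ h
  intro d hdL hdπ hd
  have hdπ' : d ∣ π := hd.dvd_of_dvd_pow hdπ
  exact hL ((hd.associated_of_dvd hπ hdπ').symm.dvd.trans hdL)

/-- **Ideal form of the cancellation**: `(π^c)·(f) ⊆ (L)` with `π` prime, `π ∤ L` gives `(f) ⊆ (L)`.
[folklore] -/
theorem span_singleton_le_of_prime_pow_mul_le {π L f : R} (hπ : Prime π) (hL : ¬ π ∣ L) (c : ℕ)
    (h : Ideal.span {π ^ c} * Ideal.span {f} ≤ Ideal.span {L}) :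
    Ideal.span {f} ≤ Ideal.span {L} := by
  rw [Ideal.span_singleton_mul_span_singleton, Ideal.span_singleton_le_span_singleton] at h
  exact Ideal.span_singleton_le_span_singleton.mpr (dvd_of_dvd_prime_pow_mul hπ hL c h)

end Cancel

/-! ### §4 Over `Λ_𝒪 = 𝒪⟦T⟧`: the end form — `Ch_Λ(M) ⊆ (L)` from congruences with a bounded
defect and `μ(L) = 0`, and the inequality at the trivial character -/

section PowerSeriesDVR

open Summit.BirchSwinnertonDyer.Rank1Residual.X11b.CongruenceLimit.PowerSeriesDVR

variable {𝒪 : Type} [CommRing 𝒪] [IsDomain 𝒪] [IsDiscreteValuationRing 𝒪]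
  [IsAdicComplete (maximalIdeal 𝒪) 𝒪]

/-- **`Ch_Λ(X^Σ_ac(E[p^∞])) ⊆ (L^Σ_p(f))` from the Greenberg side for the `g_m` WITHOUT EXACT
CONTROL — kernel form over `Λ_𝒪 = 𝒪⟦T⟧` (`𝒪` a complete DVR).** Inputs: `α`, `hα` [`M ↠ Q_m`: the dual of
`Sel^Σ_𝔭(K, M_E[p^m]) ↪ Sel^Σ_𝔭(K, M_E)[p^m]`, any `E`]; `hD` [BOUNDED DEFECT for `g_m`:
`(π^c)·Fitt₀(Q_m) ⊆ Fitt₀(N_m) + I^m`, `c` independent of `m` — from `0 → K_m → N_m/I^mN_m → Q_m → 0`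
with `#K_m ≤ p^{c'}`, exponent `p^k`, Stacks 07ZA (4)]; `hCh` [(2.5) for `g_m` as printed:
`Ch(N_m) ⊆ (L_m)` when `N_m` is torsion]; `hc` [(c)]; `hT`, `hnf` [`M` torsion with no nonzero
finite-length submodule: control (Cas18 Thm. 2.3 ⇐ JSW17) + [Gre16], as in multr1-p1's exact version];
`hπ`, `hL` [`π` prime with `π ∤ L`: `π = ϖ`, `μ(L) = 0`]. THEN `Fitt_Λ(M) = Ch_Λ(M) ⊆ (L)`. With `c = 0`
this is `CongruenceLimit.PowerSeriesDVR.charIdeal_le_span_of_congruences_printed`. Pure algebra;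
CONDITIONAL on nothing; deletes nothing. [cite: Castella2018Erratum, proof of Thm. 1.1 (p. 4), read one-sidedly and without (iv)]
[cite: Skinner2016PacificMC, §3.1 (p. 192)] -/
theorem charIdeal_le_span_of_congruences_defect
    {M : Type} [AddCommGroup M] [Module (PowerSeries 𝒪) M] [Module.Finite (PowerSeries 𝒪) M]
    (N : ℕ → Type) [∀ m, AddCommGroup (N m)] [∀ m, Module (PowerSeries 𝒪) (N m)]
    [∀ m, Module.Finite (PowerSeries 𝒪) (N m)]
    (Q : ℕ → Type) [∀ m, AddCommGroup (Q m)] [∀ m, Module (PowerSeries 𝒪) (Q m)]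
    (I : Ideal (PowerSeries 𝒪)) (hI : I ≤ (⊥ : Ideal (PowerSeries 𝒪)).jacobson)
    {L π : PowerSeries 𝒪} (hπ : Prime π) (hL : ¬ π ∣ L) (c : ℕ) (Lm : ℕ → PowerSeries 𝒪)
    (α : ∀ m : ℕ, 1 ≤ m → (M →ₗ[PowerSeries 𝒪] Q m))
    (hα : ∀ (m : ℕ) (hm : 1 ≤ m), Function.Surjective (α m hm))
    (hD : ∀ m : ℕ, 1 ≤ m →
      Ideal.span {π ^ c} * Module.fittingIdeal (PowerSeries 𝒪) (Q m) 0 ≤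
        Module.fittingIdeal (PowerSeries 𝒪) (N m) 0 ⊔ I ^ m)
    (hCh : ∀ m : ℕ, 1 ≤ m → Module.IsTorsion (PowerSeries 𝒪) (N m) →
      charIdeal (PowerSeries 𝒪) (N m) ≤ Ideal.span {Lm m})
    (hc : ∀ m : ℕ, 1 ≤ m → Ideal.span {Lm m} ⊔ I ^ m = Ideal.span {L} ⊔ I ^ m)
    (hT : Module.IsTorsion (PowerSeries 𝒪) M)
    (hnf : ∀ N' : Submodule (PowerSeries 𝒪) M, Module.length (PowerSeries 𝒪) N' ≠ ⊤ → N' = ⊥) :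
    Module.fittingIdeal (PowerSeries 𝒪) M 0 = charIdeal (PowerSeries 𝒪) M ∧
      charIdeal (PowerSeries 𝒪) M ≤ Ideal.span {L} := by
  -- the defect-tolerant limit: `(π^c)·Fitt₀(M) ⊆ (L)`
  have hFitt : Ideal.span {π ^ c} * Module.fittingIdeal (PowerSeries 𝒪) M 0 ≤ Ideal.span {L} :=
    mul_fittingIdeal_le_span_of_congruences I (Ideal.span {π ^ c}) N Q Lm hI α hα hD
      (fun m hm => fittingIdeal_zero_le_of_charIdeal_le (hCh m hm)) hc
  -- `Fitt₀(M) = Ch(M)` is principal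
  have hFC : Module.fittingIdeal (PowerSeries 𝒪) M 0 = charIdeal (PowerSeries 𝒪) M :=
    fittingIdeal_zero_eq_charIdeal_of_forall_length M hT hnf
  have hprinc : (Module.fittingIdeal (PowerSeries 𝒪) M 0).IsPrincipal :=
    fittingIdeal_zero_isPrincipal_of_forall_length M hT hnf
  obtain ⟨f, hf⟩ := hprinc
  have hf' : Module.fittingIdeal (PowerSeries 𝒪) M 0 = Ideal.span {f} := hf
  refine ⟨hFC, ?_⟩
  rw [hf'] at hFitt
  rw [← hFC, hf']
  exact span_singleton_le_of_prime_pow_mul_le hπ hL c hFitt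

/-- **At the trivial character** (one ring, `𝒪 = R₀` a complete DVR): under the same inputs, for ANY
generator `f_ac` of `Ch_Λ(M)`, `ord L(0) ≤ ord f_ac(0)` — route p2's `IMCLowerAtTrivialChar` shape
(`BDPRouteLinks.lean`), i.e. STEP L once (BDP)∘(CTL)∘(TAM) are applied — now WITHOUT the erratum's
hypothesis (iv), given the bounded defect and `μ(L) = 0`. [cite: Castella2018Erratum, proof of Thm. 1.1 (p. 4), read one-sidedly and without (iv)]
[cite: JetchevSkinnerWan2017, §7.4.1 (the lower bound from the Greenberg-side divisibility)] -/
theorem addVal_constantCoeff_le_of_congruences_defect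
    {M : Type} [AddCommGroup M] [Module (PowerSeries 𝒪) M] [Module.Finite (PowerSeries 𝒪) M]
    (N : ℕ → Type) [∀ m, AddCommGroup (N m)] [∀ m, Module (PowerSeries 𝒪) (N m)]
    [∀ m, Module.Finite (PowerSeries 𝒪) (N m)]
    (Q : ℕ → Type) [∀ m, AddCommGroup (Q m)] [∀ m, Module (PowerSeries 𝒪) (Q m)]
    (I : Ideal (PowerSeries 𝒪)) (hI : I ≤ (⊥ : Ideal (PowerSeries 𝒪)).jacobson)
    {L π : PowerSeries 𝒪} (hπ : Prime π) (hL : ¬ π ∣ L) (c : ℕ) (Lm : ℕ → PowerSeries 𝒪)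
    (α : ∀ m : ℕ, 1 ≤ m → (M →ₗ[PowerSeries 𝒪] Q m))
    (hα : ∀ (m : ℕ) (hm : 1 ≤ m), Function.Surjective (α m hm))
    (hD : ∀ m : ℕ, 1 ≤ m →
      Ideal.span {π ^ c} * Module.fittingIdeal (PowerSeries 𝒪) (Q m) 0 ≤
        Module.fittingIdeal (PowerSeries 𝒪) (N m) 0 ⊔ I ^ m)
    (hCh : ∀ m : ℕ, 1 ≤ m → Module.IsTorsion (PowerSeries 𝒪) (N m) →
      charIdeal (PowerSeries 𝒪) (N m) ≤ Ideal.span {Lm m})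
    (hc : ∀ m : ℕ, 1 ≤ m → Ideal.span {Lm m} ⊔ I ^ m = Ideal.span {L} ⊔ I ^ m)
    (hT : Module.IsTorsion (PowerSeries 𝒪) M)
    (hnf : ∀ N' : Submodule (PowerSeries 𝒪) M, Module.length (PowerSeries 𝒪) N' ≠ ⊤ → N' = ⊥)
    {fac : PowerSeries 𝒪} (hfac : charIdeal (PowerSeries 𝒪) M = Ideal.span {fac}) :
    addVal 𝒪 (constantCoeff L) ≤ addVal 𝒪 (constantCoeff fac) := by
  have h := (charIdeal_le_span_of_congruences_defect N Q I hI hπ hL c Lm α hα hD hCh hc hT hnf).2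
  rw [hfac] at h
  exact addVal_constantCoeff_le_of_span_le h

end PowerSeriesDVR

end Summit.BirchSwinnertonDyer.BirchSwinnertonDyer.Theorems.BoundedCongruenceLimit

end
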